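import Literature.AnabelianGeometry.EtaleTheta.Discharge.Sec3Thm37RatStd
import Literature.AlgebraicGeometry.Frobenioids.MonoprimeAutomorphisms
import Literature.AlgebraicGeometry.Frobenioids.PerfFactorialPrimes
import HarnessLib

/-!
# [EtTh] Theorem 3.7 (ii), second clause: the input "`Π^tp_X` acts trivially on `K^×/O_K^×`" REDUCED,
# at `ℤ`-monoprime `Φ^{bs-fld}`, to the constant line `ℝ·Φ₀^cnst` of Definition 3.6 (i)

S. Mochizuki, *The étale theta function and its Frobenioid-theoretic manifestations*, Publ. RIMS **45**
(2009) [EtTh], §3: Def. 3.6 (i)/(ii) PDF pp. 76–77 (printed pp. 302–303) and Thm. 3.7 (ii), PDF p. 79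
with proof PDF p. 80 ll. 17–20 (printed p. 306) of `paper:doi-10-2977-prims-1234361159`
[cite: MochizukiEtTh2009, Thm 3.7 (ii) p.79] [cite: MochizukiEtTh2009, Def 3.6 p.77]:

> "As for assertion (ii), let us first observe that since `Π^tp_X` acts trivially on `K^×/O_K^×`, it
> follows [cf. also the condition imposed on `F` in Definition 3.6, (ii), (b)] that every object of
> `(C^un-tr)^birat` is Frobenius-compact."

Proof-only sequel (theorems only, no definitions; cell abc-iut, layer L2, node `EtTh:Thm3.7(ii)`, seat
abc-iut-w5-d250 gen 3; cell GAP-LEDGER row G-w5d250-1) of `Discharge/Sec3Thm37RatStd.lean` (same seat,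
gen 2), whose closing theorems `thm37_ii_ratStd_treeCatVocab(')` carry print's input "`Π^tp_X` acts trivially
on `K^×/O_K^×`" as the explicit binder `hKfix` (the pull-back along every automorphism `f` of `A` in `D`
FIXES the divisor `ξ ∈ Φ(A)^gp` of every CONSTANT rational function `b ∈ F(A)`), an Aut-invariance datum
that the abstract Def. 3.6 interface `RealifiedDivisorMonoids`/`TemperedFrobenioid` does not carry.  Here
that datum is DERIVED — for tempered Frobenioids whose monoid of base-field divisors `Φ^{bs-fld}(A)`
(Def. 3.6 (ii)(a): "monoprime") is `ℤ`-MONOPRIME, the case of monoid type `Λ = ℤ` in print — from two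
properties of the Def. 3.6 (i) DATA stated VERBATIM as in `Discharge/Sec3Def36NonzeroConstants.lean`
(abc-iut-w4-d008, binders of GAP row G-w5d124-2, the proposed successor field of the interface):

* `hLine` — every element of the constant line `ℝ·Φ₀^cnst(Y) ⊆ (Φ₀^ℝ)^gp(Y)` is EFFECTIVE or ANTI-EFFECTIVE
  (print: `ℝ·Φ₀^cnst(Y) = ℝ·div(ϖ)`, the real line through the effective divisor of a uniformiser — Prop. 3.4
  (ii) `L^× ⥲ F₀(Y)`, PDF p. 74, inside the `ℝ`-vector space `(Φ₀^rlf)^gp`, [FrdI] Def. 2.4 (i));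
* `hInt` — `Φ₀^ℝ(Y) = Φ₀(Y)^rlf ⊆ ∏_𝔭 ℝ_{≥0}` is integral (cancellative) ([FrdI] Def. 2.4 (i)(c)).

The argument (print's one line unwound over the abstract data):
1. `pull_bsFld_eq_self_of_isZMonoprime` — the pull-back `Φ(f)`, `f ∈ Aut_D(A)`, restricts to a monoid
   AUTOMORPHISM of `Φ^{bs-fld}(A)` (both `Φ` and `(ℝ·Φ₀^cnst)|_D` are pull-back stable), hence is the IDENTITY
   there when `Φ^{bs-fld}(A) ≅ ℤ_{≥0}` (`Aut(ℤ_{≥0}) = 1`, `IsZMonoprime.mulEquiv_apply` of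
   `Frobenioids/MonoprimeAutomorphisms.lean`, [FrdI] §0 p. 10);
2. `pullGp_cnst_eq_self_of_line` — the divisor `ξ = x/y ∈ Φ(A)^gp` of a constant `b ∈ F₀^Λ(Y_A)` lies on the
   constant line (`divΛ_mem_cnstR`), so by `hLine` it is `r^{±1}` with `r ∈ Φ₀^ℝ(Y_A)` effective; by `hInt`
   `x = r·y` (resp. `y = r·x`), so `r ∈ Φ(A)` by the group-saturation of `Φ ⊆ Φ^{ℝ-log}` (Def. 3.6 (ii)), i.e.
   `r ∈ Φ^{bs-fld}(A)` and `ξ = of(r)^{±1}`; hence ANY automorphism whose pull-back fixes `Φ^{bs-fld}(A)`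
   pointwise fixes `ξ` — this is `hKfix`;
2′. `pull_bsFld_eq_self_of_iterate_eq` / `pullGp_cnst_eq_self_of_line_of_iterate_eq` — the same for
   `Φ^{bs-fld}(A)` monoprime of ANY type when the pull-back has FINITE ORDER on `Φ^{bs-fld}(A)`: a monoid
   endomorphism of finite order of a monoid totally ordered by divisibility is the identity
   (`apply_eq_self_of_dvd_total_of_iterate_eq`, `monoprime_dvd_antisymm`, `IsMonoprime.dvd_total`);
3. `exists_isFrobeniusCompact_untrBirat_treeCatVocab_of_line`, `thm37_ii_ratStd_treeCatVocab_of_line(')` —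
   gen 2's theorems with `hKfix` discharged by 1–2: "every object of `(C^un-tr)^birat` is Frobenius-compact"
   and **Thm. 3.7 (ii), second clause, at the canonical vocabulary and THE [FrdI] Def. 4.5 parameters**, now
   modulo `hBmon`/`hD`/`hnd`/`hrat` (as before) and `hLine`, `hInt`, `hZ` — properties of the Def. 3.3 (iii) /
   3.6 (i)–(ii)(a) data ALONE (no automorphism-invariance input).
So ONE successor field of the Def. 3.6 (i) interface (`hLine` + `hInt`, wanted independently for the
bracketed sentence of Def. 3.6 (ii)(b), G-w5d124-2) closes G-w5d250-1 as well at `ℤ`-monoprime `Φ^{bs-fld}`.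
CENSUS (honest): for `ℚ`- or `ℝ`-monoprime `Φ^{bs-fld}(A)` step 1 fails as stated (`Aut(ℚ_{≥0}) = ℚ_{>0}`,
`Aut(ℝ_{≥0}) ⊇ ℝ_{>0}`): there an automorphism-level input remains necessary — that `Aut_D(A)` acts on
`Φ^{bs-fld}(A)` through a torsion group (the genre of Thm. 3.7 (iii), `Aut_{D^cnst}(A^cnst)`), which step 2′ turns
into `hKfix`; step 2 (`pullGp_cnst_eq_self_of_line`, hypothesis `hfix`) accepts any such input.  HONEST FRAMING:
refereed pre-IUT material ([EtTh] §3 over [FrdI] §4–§5); nothing here bears on [IUTchIII] Cor. 3.12; no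
statement of either paper is strengthened; typed ≠ proved — here PROVED modulo the named inputs.
-/

namespace Literature.AnabelianGeometry.EtaleTheta

open CategoryTheory Opposite Literature.AlgebraicGeometry.Frobenioids

universe u₀ v₀ u v w

/-! ### §0 Folklore algebra in the Grothendieck group of an integral monoid -/

section Integral

variable {M : Type*} [CommMonoid M]

/-- Every element of `M^gp` is a fraction `x/y` of elements of `M`. [folklore] -/
private theorem gp_exists_eq_div (ξ : Algebra.GrothendieckGroup M) :
    ∃ x y : M, ξ = Algebra.GrothendieckGroup.of x / Algebra.GrothendieckGroup.of y := by
  obtain ⟨⟨x, y⟩, h⟩ := (Localization.monoidOf (⊤ : Submonoid M)).surj ξ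
  exact ⟨x, y, eq_div_iff_mul_eq'.mpr h⟩

/-- In an integral monoid, `r = x/y` in `M^gp` forces `x = r·y`. [folklore] -/
private theorem eq_mul_of_of_eq_div (hM : IsCancelMul M) {x y r : M}
    (h : Algebra.GrothendieckGroup.of r = Algebra.GrothendieckGroup.of x / Algebra.GrothendieckGroup.of y) :
    x = r * y := by
  haveI := hM
  apply Algebra.GrothendieckGroup.of_injective
  rw [map_mul, h, div_mul_cancel]

/-- In an integral monoid, `r⁻¹ = x/y` in `M^gp` forces `y = r·x`. [folklore] -/
private theorem eq_mul_of_of_inv_eq_div (hM : IsCancelMul M) {x y r : M}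
    (h : (Algebra.GrothendieckGroup.of r)⁻¹ = Algebra.GrothendieckGroup.of x / Algebra.GrothendieckGroup.of y) :
    y = r * x := by
  haveI := hM
  apply Algebra.GrothendieckGroup.of_injective
  rw [map_mul, ← inv_inv (Algebra.GrothendieckGroup.of r), h, inv_div, div_mul_cancel]

/-- In `Λ_{≥0}` (written multiplicatively), for a canonically ordered `Λ`, divisibility is antisymmetric.
[folklore] -/
private theorem dvd_antisymm_of_mulEquiv_multiplicative {N : Type*} [CommMonoid N] {Λ : Type*}
    [AddCommMonoid Λ] [PartialOrder Λ] [CanonicallyOrderedAdd Λ] (e : N ≃* Multiplicative Λ)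
    {a b : N} (h₁ : a ∣ b) (h₂ : b ∣ a) : a = b := by
  have key : ∀ {x y : N}, x ∣ y → Multiplicative.toAdd (e x) ≤ Multiplicative.toAdd (e y) := by
    rintro x y ⟨c, rfl⟩
    rw [map_mul, toAdd_mul]
    exact le_self_add
  exact e.injective (Multiplicative.toAdd.injective (le_antisymm (key h₁) (key h₂)))

/-- In a monoprime monoid (`≅ ℤ_{≥0}, ℚ_{≥0}` or `ℝ_{≥0}`, [FrdI] §0 p. 10) divisibility is antisymmetric.
[cite: MochizukiFrdI2008, §0 p.10] -/
theorem monoprime_dvd_antisymm {N : Type*} [CommMonoid N] (h : IsMonoprime N) {a b : N} (h₁ : a ∣ b)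
    (h₂ : b ∣ a) : a = b := by
  rcases h with ⟨⟨⟨e⟩⟩⟩ | ⟨⟨⟨e⟩⟩⟩ | ⟨⟨⟨e⟩⟩⟩
  · exact dvd_antisymm_of_mulEquiv_multiplicative e h₁ h₂
  · exact dvd_antisymm_of_mulEquiv_multiplicative e h₁ h₂
  · exact dvd_antisymm_of_mulEquiv_multiplicative e h₁ h₂

/-- **A monoid endomorphism of FINITE ORDER of a monoid totally ordered by divisibility is the identity**
(e.g. of `ℤ_{≥0}`, `ℚ_{≥0}`, `ℝ_{≥0}`: an automorphism of `ℚ_{≥0}` or `ℝ_{≥0}` is a homothety `x ↦ c·x`, and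
`c^n = 1`, `c > 0` force `c = 1`; here order-theoretically, without the homothety description): if `x ≤ σ(x)`
then `σ(x) ≤ σ²(x) ≤ ⋯ ≤ σⁿ(x) = x`, so `σ(x) = x` by antisymmetry, and symmetrically if `σ(x) ≤ x`.  (Used
for the monoprime monoids `ℤ_{≥0}, ℚ_{≥0}, ℝ_{≥0}` of [FrdI] §0 p. 10.) [cite: MochizukiFrdI2008, §0 p.10] -/
theorem apply_eq_self_of_dvd_total_of_iterate_eq {N : Type*} [CommMonoid N]
    (htot : ∀ a b : N, a ∣ b ∨ b ∣ a) (hanti : ∀ {a b : N}, a ∣ b → b ∣ a → a = b)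
    (σ : N →* N) {n : ℕ} (hn : 0 < n) (hσ : ∀ x, σ^[n] x = x) (x : N) : σ x = x := by
  -- iterates of `σ` preserve divisibility
  have hiter : ∀ (k : ℕ) {a b : N}, a ∣ b → σ^[k] a ∣ σ^[k] b := by
    intro k
    induction k with
    | zero => intro a b h; exact h
    | succ k ih =>
      intro a b h
      rw [Function.iterate_succ_apply', Function.iterate_succ_apply']
      exact map_dvd σ (ih h)
  obtain ⟨m, rfl⟩ := Nat.exists_eq_add_one_of_ne_zero hn.ne'
  rcases htot x (σ x) with h | h
  · -- `x ∣ σ x`: then `σ x ∣ σ^[k+1] x` for every `k`, in particular `σ x ∣ σ^[m+1] x = x`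
    have hchain : ∀ k : ℕ, σ x ∣ σ^[k + 1] x := by
      intro k
      induction k with
      | zero => exact dvd_rfl
      | succ k ih =>
        have h' := hiter (k + 1) h
        rw [← Function.iterate_succ_apply σ (k + 1) x] at h'
        exact dvd_trans ih h'
    have hx : σ x ∣ x := by
      have h' := hchain m
      rwa [hσ] at h'
    exact hanti hx h
  · -- `σ x ∣ x`: then `σ^[k+1] x ∣ σ x` for every `k`, in particular `x = σ^[m+1] x ∣ σ x`
    have hchain : ∀ k : ℕ, σ^[k + 1] x ∣ σ x := by
      intro k
      induction k with
      | zero => exact dvd_rfl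
      | succ k ih =>
        have h' := hiter (k + 1) h
        rw [← Function.iterate_succ_apply σ (k + 1) x] at h'
        exact dvd_trans h' ih
    have hx : x ∣ σ x := by
      have h' := hchain m
      rwa [hσ] at h'
    exact (hanti hx h).symm

end Integral

variable {D₀ : Type u₀} [Category.{v₀} D₀] {V : FrdIMonoidStub.{w}}
  {T : RealifiedDivisorMonoids (D₀ := D₀) V} {D : Type u} [Category.{v} D]

namespace TemperedFrobenioid

/-! ### §1 Pull-backs along automorphisms act trivially on a `ℤ`-monoprime `Φ^{bs-fld}(A)` -/

section General

variable {VD : FrdICatStub.{u, v, w} D} (C : TemperedFrobenioid T D VD)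

/-- **Step 1 — `Aut_D(A)` acts trivially on a `ℤ`-monoprime `Φ^{bs-fld}(A)`.**  For an automorphism `f` of
`A` in `D`, the pull-back `Φ(f) : Φ(A) → Φ(A)` (Def. 3.6 (ii): `Φ ⊆ Φ^{ℝ-log} = Φ₀^ℝ|_D` is a subfunctor in
monoids) restricts to a monoid AUTOMORPHISM of `Φ^{bs-fld}(A) = (ℝ·Φ₀^cnst)|_D ×_{(Φ^{ℝ-log})^gp} Φ (A)` (Def. 3.6
(ii)(a); `ℝ·Φ₀^cnst` is pull-back stable, `cnstR_map`) — the value of the monoid `Φ^{bs-fld}` on `D` at the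
isomorphism `f` — and every monoid automorphism of `ℤ_{≥0}` is the identity ([FrdI] §0 p. 10,
`IsZMonoprime.mulEquiv_apply`); so `Φ(f)` fixes every base-field divisor `a ∈ Φ^{bs-fld}(A)`.
[cite: MochizukiEtTh2009, Def 3.6 p.77] -/
theorem pull_bsFld_eq_self_of_isZMonoprime (A : D) (hZ : IsZMonoprime (C.bsFld.carrier (op A)))
    (f : A ≅ A) (a : C.Φ.carrier (op A)) (ha : (a : C.ΦRlog.obj (op A)) ∈ C.bsFld.carrier (op A)) :
    C.Φ.pull f.hom.op a = a := by
  -- the automorphism of `Φ^{bs-fld}(A)` induced by `f` (functoriality of `Φ^{bs-fld}` on the isomorphism `f`)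
  let e : C.bsFld.carrier (op A) ≃* C.bsFld.carrier (op A) :=
    (C.bsFldMonoid.mapIso (Iso.op f)).commMonCatIsoToMulEquiv
  have h : ((e ⟨a, ha⟩ : C.bsFld.carrier (op A)) : C.ΦRlog.obj (op A)) = a :=
    congrArg Subtype.val (hZ.mulEquiv_apply e ⟨a, ha⟩)
  exact Subtype.ext h

/-- **Step 1′ — for `Φ^{bs-fld}(A)` monoprime of ANY type (`ℤ`, `ℚ` or `ℝ`): a pull-back of FINITE ORDER on
`Φ^{bs-fld}(A)` acts trivially there.**  If the automorphism of `Φ^{bs-fld}(A)` induced by `f ∈ Aut_D(A)` (Step 1)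
has finite order `n ≥ 1` — e.g. because `Aut_D(A)` acts on `Φ^{bs-fld}(A)` through a finite group, the genre of
Thm. 3.7 (iii) (`Aut_{D^cnst}(A^cnst)`) — then it is the identity: `Φ^{bs-fld}(A)` is totally ordered by
divisibility (`IsMonoprime.dvd_total`, `monoprime_dvd_antisymm`) and
`apply_eq_self_of_dvd_total_of_iterate_eq` applies.  This is the input under which Step 2 discharges `hKfix`
beyond the `ℤ`-monoprime case. [cite: MochizukiEtTh2009, Def 3.6 p.77] -/
theorem pull_bsFld_eq_self_of_iterate_eq (A : D) (f : A ≅ A) {n : ℕ} (hn : 0 < n)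
    (hper : ∀ x : C.bsFld.carrier (op A), (C.bsFld.pull f.hom.op)^[n] x = x)
    (a : C.Φ.carrier (op A)) (ha : (a : C.ΦRlog.obj (op A)) ∈ C.bsFld.carrier (op A)) :
    C.Φ.pull f.hom.op a = a := by
  have hmono : IsMonoprime (C.bsFld.carrier (op A)) := C.isMonoprime_bsFld (op A)
  have h := apply_eq_self_of_dvd_total_of_iterate_eq hmono.dvd_total
    (fun h₁ h₂ => monoprime_dvd_antisymm hmono h₁ h₂) (C.bsFld.pull f.hom.op) hn hper ⟨a, ha⟩
  have h' : ((C.bsFld.pull f.hom.op ⟨a, ha⟩ : C.bsFld.carrier (op A)) : C.ΦRlog.obj (op A)) = a :=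
    congrArg Subtype.val h
  exact Subtype.ext h'

/-! ### §2 Constants' divisors lie in `(Φ^{bs-fld})^{gp}` as `r^{±1}` — hence are fixed -/

/-- **Step 2 — the divisor of a constant rational function is fixed by every pull-back fixing `Φ^{bs-fld}(A)`
pointwise.**  For `b ∈ F₀^Λ(Y_A)` and `ξ ∈ Φ(A)^gp` with `(b, ξ) ∈ B(A) = B₀^Λ|_D ×_{(Φ^{ℝ-log})^gp} Φ^gp (A)` (so
`(b, ξ) ∈ F(A)`): `div(b) = ξ` lies on the constant line `ℝ·Φ₀^cnst(Y_A)` (Def. 3.6 (i), `divΛ_mem_cnstR`),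
hence (`hLine`) `ξ = r` or `ξ = r⁻¹` in `(Φ₀^ℝ)^gp(Y_A)` with `r ∈ Φ₀^ℝ(Y_A)`; writing `ξ = x/y` with
`x, y ∈ Φ(A)`, integrality of `Φ₀^ℝ(Y_A)` (`hInt`) gives `x = r·y` (resp. `y = r·x`), so `r ∈ Φ(A)` because
`Φ(A)` is group-saturated in `Φ^{ℝ-log}(A)` (Def. 3.6 (ii)), i.e. `r ∈ Φ^{bs-fld}(A)` and `ξ = of(r)^{±1}`.
Consequently the pull-back `Φ(f)` along any `f ∈ Aut_D(A)` fixing `Φ^{bs-fld}(A)` pointwise (`hfix`; e.g.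
Step 1) fixes `ξ` — print's "since `Π^tp_X` acts trivially on `K^×/O_K^×`" (Thm. 3.7 (ii), proof, PDF p. 80),
the binder `hKfix` of `thm37_ii_ratStd_treeCatVocab`. [cite: MochizukiEtTh2009, Thm 3.7 (ii) p.79] -/
theorem pullGp_cnst_eq_self_of_line (A : D)
    (hLine : ∀ (Y : D₀ᵒᵖ) (g : Algebra.GrothendieckGroup (T.ΦR.obj Y)), g ∈ T.cnstR Y →
      ∃ r : T.ΦR.obj Y, g = Algebra.GrothendieckGroup.of r ∨ g = (Algebra.GrothendieckGroup.of r)⁻¹)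
    (hInt : ∀ Y : D₀ᵒᵖ, IsCancelMul (T.ΦR.obj Y))
    (f : A ≅ A)
    (hfix : ∀ a : C.Φ.carrier (op A), (a : C.ΦRlog.obj (op A)) ∈ C.bsFld.carrier (op A) →
      C.Φ.pull f.hom.op a = a)
    (b : T.BΛ.obj (C.baseOp (op A))) (ξ : Algebra.GrothendieckGroup (C.Φ.carrier (op A)))
    (hb : b ∈ T.FΛ (C.baseOp (op A))) (hbξ : (b, ξ) ∈ C.ratFn (op A)) :
    pullGp C.divisorMonoid f.hom ξ = ξ := by
  have hdiv : T.divΛ (C.baseOp (op A)) b = C.ΦgpToRlog (op A) ξ := hbξ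
  have hmem : C.ΦgpToRlog (op A) ξ ∈ T.cnstR (C.baseOp (op A)) := hdiv ▸ T.divΛ_mem_cnstR _ b hb
  obtain ⟨x, y, rfl⟩ := gp_exists_eq_div ξ
  have hxy : C.ΦgpToRlog (op A) (Algebra.GrothendieckGroup.of x / Algebra.GrothendieckGroup.of y) =
      Algebra.GrothendieckGroup.of (x : C.ΦRlog.obj (op A)) /
        Algebra.GrothendieckGroup.of (y : C.ΦRlog.obj (op A)) := by
    rw [map_div, ΦgpToRlog, gpMap_of, gpMap_of]
    rfl
  rw [hxy] at hmem
  obtain ⟨r, hr | hr⟩ := hLine _ _ hmem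
  · -- effective case: `x = r·y`, `r ∈ Φ^{bs-fld}(A)`, `ξ = of(r)`
    have hxry := eq_mul_of_of_eq_div (hInt (C.baseOp (op A))) hr.symm
    have hrΦ : r ∈ C.Φ.carrier (op A) :=
      (isGroupSaturated_iff' _).1 (C.isGroupSaturated (op A)) r x x.2 y y.2 hxry.symm
    have hrbs : ((⟨r, hrΦ⟩ : C.Φ.carrier (op A)) : C.ΦRlog.obj (op A)) ∈ C.bsFld.carrier (op A) :=
      ⟨hrΦ, show Algebra.GrothendieckGroup.of r ∈ T.cnstR (C.baseOp (op A)) from hr ▸ hmem⟩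
    have hx : x = ⟨r, hrΦ⟩ * y := Subtype.ext hxry
    subst hx
    have hξ : Algebra.GrothendieckGroup.of ((⟨r, hrΦ⟩ : C.Φ.carrier (op A)) * y) /
        Algebra.GrothendieckGroup.of y = Algebra.GrothendieckGroup.of (⟨r, hrΦ⟩ : C.Φ.carrier (op A)) := by
      rw [map_mul, mul_div_assoc, div_self', mul_one]
    rw [hξ]
    have h1 := pullGp_of (Φ := C.divisorMonoid) f.hom (⟨r, hrΦ⟩ : C.Φ.carrier (op A))
    have h2 := congrArg Algebra.GrothendieckGroup.of (hfix ⟨r, hrΦ⟩ hrbs)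
    exact h1.trans h2
  · -- anti-effective case: `y = r·x`, `r ∈ Φ^{bs-fld}(A)`, `ξ = of(r)⁻¹`
    have hyrx := eq_mul_of_of_inv_eq_div (hInt (C.baseOp (op A))) hr.symm
    have hrΦ : r ∈ C.Φ.carrier (op A) :=
      (isGroupSaturated_iff' _).1 (C.isGroupSaturated (op A)) r y y.2 x x.2 hyrx.symm
    have hrbs : ((⟨r, hrΦ⟩ : C.Φ.carrier (op A)) : C.ΦRlog.obj (op A)) ∈ C.bsFld.carrier (op A) := by
      refine ⟨hrΦ, show Algebra.GrothendieckGroup.of r ∈ T.cnstR (C.baseOp (op A)) from ?_⟩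
      rw [← inv_inv (Algebra.GrothendieckGroup.of r), ← hr]
      exact (T.cnstR (C.baseOp (op A))).inv_mem hmem
    have hy : y = ⟨r, hrΦ⟩ * x := Subtype.ext hyrx
    subst hy
    have hξ : Algebra.GrothendieckGroup.of x /
        Algebra.GrothendieckGroup.of ((⟨r, hrΦ⟩ : C.Φ.carrier (op A)) * x) =
          (Algebra.GrothendieckGroup.of (⟨r, hrΦ⟩ : C.Φ.carrier (op A)))⁻¹ := by
      rw [map_mul, div_mul_eq_div_div_swap, div_self', one_div]
    rw [hξ]
    have h1 := pullGp_of (Φ := C.divisorMonoid) f.hom (⟨r, hrΦ⟩ : C.Φ.carrier (op A))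
    have h2 := congrArg Algebra.GrothendieckGroup.of (hfix ⟨r, hrΦ⟩ hrbs)
    exact (map_inv (pullGp C.divisorMonoid f.hom) _).trans (congrArg Inv.inv (h1.trans h2))

/-- **Steps 1 + 2: print's input "`Π^tp_X` acts trivially on `K^×/O_K^×`" DERIVED at `ℤ`-monoprime
`Φ^{bs-fld}(A)`** — the binder `hKfix` of `thm37_ii_ratStd_treeCatVocab` (pull-backs along automorphisms of
`A` fix the divisors of constant rational functions) from `hLine`, `hInt` (Def. 3.6 (i) data) and
`Φ^{bs-fld}(A) ≅ ℤ_{≥0}`. [cite: MochizukiEtTh2009, Thm 3.7 (ii) p.79] -/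
theorem pullGp_cnst_eq_self_of_line_of_isZMonoprime (A : D)
    (hLine : ∀ (Y : D₀ᵒᵖ) (g : Algebra.GrothendieckGroup (T.ΦR.obj Y)), g ∈ T.cnstR Y →
      ∃ r : T.ΦR.obj Y, g = Algebra.GrothendieckGroup.of r ∨ g = (Algebra.GrothendieckGroup.of r)⁻¹)
    (hInt : ∀ Y : D₀ᵒᵖ, IsCancelMul (T.ΦR.obj Y)) (hZ : IsZMonoprime (C.bsFld.carrier (op A)))
    (f : A ≅ A) (b : T.BΛ.obj (C.baseOp (op A))) (ξ : Algebra.GrothendieckGroup (C.Φ.carrier (op A)))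
    (hb : b ∈ T.FΛ (C.baseOp (op A))) (hbξ : (b, ξ) ∈ C.ratFn (op A)) :
    pullGp C.divisorMonoid f.hom ξ = ξ :=
  C.pullGp_cnst_eq_self_of_line A hLine hInt f (C.pull_bsFld_eq_self_of_isZMonoprime A hZ f) b ξ hb hbξ

/-- **Steps 1′ + 2: `hKfix` along an automorphism whose pull-back has finite order on `Φ^{bs-fld}(A)`** (any
monoid type), from `hLine`, `hInt`. [cite: MochizukiEtTh2009, Thm 3.7 (ii) p.79] -/
theorem pullGp_cnst_eq_self_of_line_of_iterate_eq (A : D)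
    (hLine : ∀ (Y : D₀ᵒᵖ) (g : Algebra.GrothendieckGroup (T.ΦR.obj Y)), g ∈ T.cnstR Y →
      ∃ r : T.ΦR.obj Y, g = Algebra.GrothendieckGroup.of r ∨ g = (Algebra.GrothendieckGroup.of r)⁻¹)
    (hInt : ∀ Y : D₀ᵒᵖ, IsCancelMul (T.ΦR.obj Y)) (f : A ≅ A) {n : ℕ} (hn : 0 < n)
    (hper : ∀ x : C.bsFld.carrier (op A), (C.bsFld.pull f.hom.op)^[n] x = x)
    (b : T.BΛ.obj (C.baseOp (op A))) (ξ : Algebra.GrothendieckGroup (C.Φ.carrier (op A)))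
    (hb : b ∈ T.FΛ (C.baseOp (op A))) (hbξ : (b, ξ) ∈ C.ratFn (op A)) :
    pullGp C.divisorMonoid f.hom ξ = ξ :=
  C.pullGp_cnst_eq_self_of_line A hLine hInt f (C.pull_bsFld_eq_self_of_iterate_eq A f hn hper) b ξ hb hbξ

end General

/-! ### §3 Theorem 3.7 (ii), second clause, with `hKfix` discharged -/

section TreeVocab

variable {IsRational IsStrictlyRational : (Dᵒᵖ ⥤ CommMonCat.{w}) → Prop}
  (C₀ : TemperedFrobenioid T D (treeCatVocab D IsRational IsStrictlyRational))

/-- **"Every object of `(C^un-tr)^birat` is Frobenius-compact" — the instance print uses, WITHOUT the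
automorphism-invariance input**: at an object `A ∈ Ob(D)` with `Φ^{bs-fld}(A)` `ℤ`-monoprime, given `hLine`,
`hInt` (Def. 3.6 (i) data), a Frobenius-compact object of `(C^un-tr)^birat` over `A` exists (gen 2's
`exists_isFrobeniusCompact_untrBirat_treeCatVocab` with `hKfix := pullGp_cnst_eq_self_of_line_of_isZMonoprime`).
[cite: MochizukiEtTh2009, Thm 3.7 (ii) p.79] -/
theorem exists_isFrobeniusCompact_untrBirat_treeCatVocab_of_line (hBmon : IsMonoidOn C₀.ratFnFunctor) (A : D)
    (hLine : ∀ (Y : D₀ᵒᵖ) (g : Algebra.GrothendieckGroup (T.ΦR.obj Y)), g ∈ T.cnstR Y →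
      ∃ r : T.ΦR.obj Y, g = Algebra.GrothendieckGroup.of r ∨ g = (Algebra.GrothendieckGroup.of r)⁻¹)
    (hInt : ∀ Y : D₀ᵒᵖ, IsCancelMul (T.ΦR.obj Y)) (hZ : IsZMonoprime (C₀.bsFld.carrier (op A))) :
    ∃ Y : PreFrobenioid.Birat (PreFrobenioid.untrFunctor (C₀.isFrobenioid_treeCatVocab_of_isMonoidOn hBmon))
        (PreFrobenioid.isFrobenioid_untr (C₀.isFrobenioid_treeCatVocab_of_isMonoidOn hBmon))
        (PreFrobenioid.hasBiratSquares_untr (C₀.isFrobenioid_treeCatVocab_of_isMonoidOn hBmon)),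
      (PreFrobenioid.biratOps
          (PreFrobenioid.isFrobenioid_untr (C₀.isFrobenioid_treeCatVocab_of_isMonoidOn hBmon))
          (PreFrobenioid.hasBiratSquares_untr (C₀.isFrobenioid_treeCatVocab_of_isMonoidOn hBmon))).IsFrobeniusCompact
        Y :=
  C₀.exists_isFrobeniusCompact_untrBirat_treeCatVocab hBmon A
    (C₀.pullGp_cnst_eq_self_of_line_of_isZMonoprime A hLine hInt hZ)

/-- **[EtTh] Thm. 3.7 (ii), second clause, at the canonical vocabulary and THE [FrdI] Def. 4.5 parameters,
WITHOUT the automorphism-invariance input**: "If, moreover, `Φ` is rational, then `C` is of rationally standard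
type" — for the tempered Frobenioid `C`, given `hBmon` ([FrdI] Thm. 5.2 preamble), `D` of FSMFF-type and `Φ`
non-dilating (first clause), "`Φ` rational" at THE support (`hrat`), and — in place of gen 2's `hKfix` — the
constant-line properties `hLine`, `hInt` of the Def. 3.6 (i) data together with `Φ^{bs-fld}(A)` `ℤ`-monoprime
at one object `A`. [cite: MochizukiEtTh2009, Thm 3.7 (ii) p.79] -/
theorem thm37_ii_ratStd_treeCatVocab_of_line (hBmon : IsMonoidOn C₀.ratFnFunctor) (hD : IsOfFSMFFType D)
    (hnd : IsNonDilatingOn C₀.divisorMonoid)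
    (hrat : ∀ X : C₀.category,
      PreFrobenioidData.IsRational
        (PreFrobenioid.biratData (C₀.isFrobenioid_treeCatVocab_of_isMonoidOn hBmon)
          (PreFrobenioid.hasBiratSquares_of_isFrobenioid (C₀.isFrobenioid_treeCatVocab_of_isMonoidOn hBmon)))
        (S := PreFrobenioidData.ofFunctor C₀.divisorMonoid C₀.toElem) (fun a 𝔭 => PrimarySupp a 𝔭) X)
    (A : D)
    (hLine : ∀ (Y : D₀ᵒᵖ) (g : Algebra.GrothendieckGroup (T.ΦR.obj Y)), g ∈ T.cnstR Y →
      ∃ r : T.ΦR.obj Y, g = Algebra.GrothendieckGroup.of r ∨ g = (Algebra.GrothendieckGroup.of r)⁻¹)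
    (hInt : ∀ Y : D₀ᵒᵖ, IsCancelMul (T.ΦR.obj Y)) (hZ : IsZMonoprime (C₀.bsFld.carrier (op A))) :
    (PreFrobenioidData.ofFunctor C₀.divisorMonoid C₀.toElem).IsOfRationallyStandardType
      (PreFrobenioid.rsParams (C₀.isFrobenioid_treeCatVocab_of_isMonoidOn hBmon) fun a 𝔭 => PrimarySupp a 𝔭) :=
  C₀.thm37_ii_ratStd_treeCatVocab hBmon hD hnd hrat A
    (C₀.pullGp_cnst_eq_self_of_line_of_isZMonoprime A hLine hInt hZ)

/-- **The same with `Φ^{bs-fld}` `ℤ`-monoprime at every object** (the objectwise form in which Def. 3.6 (ii)(a)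
states monoprimality; `D` is connected, hence nonempty). [cite: MochizukiEtTh2009, Thm 3.7 (ii) p.79] -/
theorem thm37_ii_ratStd_treeCatVocab_of_line' (hBmon : IsMonoidOn C₀.ratFnFunctor) (hD : IsOfFSMFFType D)
    (hnd : IsNonDilatingOn C₀.divisorMonoid)
    (hrat : ∀ X : C₀.category,
      PreFrobenioidData.IsRational
        (PreFrobenioid.biratData (C₀.isFrobenioid_treeCatVocab_of_isMonoidOn hBmon)
          (PreFrobenioid.hasBiratSquares_of_isFrobenioid (C₀.isFrobenioid_treeCatVocab_of_isMonoidOn hBmon)))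
        (S := PreFrobenioidData.ofFunctor C₀.divisorMonoid C₀.toElem) (fun a 𝔭 => PrimarySupp a 𝔭) X)
    (hLine : ∀ (Y : D₀ᵒᵖ) (g : Algebra.GrothendieckGroup (T.ΦR.obj Y)), g ∈ T.cnstR Y →
      ∃ r : T.ΦR.obj Y, g = Algebra.GrothendieckGroup.of r ∨ g = (Algebra.GrothendieckGroup.of r)⁻¹)
    (hInt : ∀ Y : D₀ᵒᵖ, IsCancelMul (T.ΦR.obj Y))
    (hZ : ∀ A : D, IsZMonoprime (C₀.bsFld.carrier (op A))) :
    (PreFrobenioidData.ofFunctor C₀.divisorMonoid C₀.toElem).IsOfRationallyStandardType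
      (PreFrobenioid.rsParams (C₀.isFrobenioid_treeCatVocab_of_isMonoidOn hBmon) fun a 𝔭 => PrimarySupp a 𝔭) :=
  C₀.thm37_ii_ratStd_treeCatVocab' hBmon hD hnd hrat fun A =>
    C₀.pullGp_cnst_eq_self_of_line_of_isZMonoprime A hLine hInt (hZ A)

end TreeVocab

end TemperedFrobenioid

end Literature.AnabelianGeometry.EtaleTheta
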